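import Literature.MathematicalPhysics.QuantumLattice.HubbardHubbardModelPairDecayProofs
import Literature.MathematicalPhysics.QuantumLattice.HubbardHubbardModelKomaTasakiProofs
import Literature.MathematicalPhysics.QuantumLattice.HeisenbergOrderMerminWagnerHeisenbergProofs
import HarnessLib

/-!
# Koma–Tasaki 1992: no STAGGERED (η-pair, antiferromagnetic) thermal long-range order in the
# two-dimensional Hubbard model

Topic `MathematicalPhysics/QuantumLattice` (family `hubbard`, statement hubbard.S11); sibling PROOF
file of `HubbardHubbardModel.lean`. The tree's corollary `koma_tasaki_noLRO` (PROVED: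
`koma_tasaki_noLRO_of koma_tasaki_2d_holds koma_tasaki_magnetic_holds`) excludes UNIFORM
(`q = 0`) long-range order of the thermal pair and transverse-spin two-point functions on
`(ℤ/Lℤ)²`, `¬ HasTorusLRO`. The printed remark after Koma–Tasaki's Theorem is sign-blind — the
power-law DECAY (2)–(4) "rigorously rule[s] out the possibility of the corresponding condensations
of electrons or electron pairs and of the corresponding magnetic ordering. The bound (2), for
example, inhibits the condensation of singlet electron pairs such as the Cooper pairs **or the
η-pairs**" — i.e. it equally excludes the STAGGERED (`q = (π,π)`) orders: Yang's η-pairing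
condensate (staggered on-site pair field) and Néel (antiferromagnetic) order of the transverse
spins. This file proves these two staggered forms, which the tree did not state, using the
staggered summation lemma `MerminWagner.not_hasStaggeredEvenTorusLRO_of_abs_le_rpow`
(`|(-1)^{x+y} G| = |G|`) of `HeisenbergOrderMerminWagnerHeisenbergProofs.lean`:

* `not_hasStaggeredEvenTorusLRO_thermalPairCorr`, `not_hasStaggeredEvenTorusLRO_thermalSpinCorr`
  — the reductions from a uniform power-law bound (any `t, U, μ, β`, as for the tree's
  `not_hasTorusLRO_thermalPairCorr` / `_thermalSpinCorr`);
* `hubbard_thermal_not_staggeredPairLRO`, `hubbard_thermal_not_staggeredSpinLRO` — UNCONDITIONAL,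
  from `koma_tasaki_2d_holds` / `koma_tasaki_magnetic_holds`: for all `t, U, μ` and `0 < β < ∞`,
  `¬ HasStaggeredEvenTorusLRO (thermalPairCorr β t U μ)` (no η-pairing off-diagonal long-range
  order at `T > 0` in `d = 2`, in contrast with Yang's exact η-paired EIGENSTATES,
  `yang_etaPairing_hasODLRO_holds`) and `¬ HasStaggeredEvenTorusLRO (thermalSpinCorr β t U μ)` (no
  transverse Néel order of the 2D Hubbard model at any `T > 0` — the itinerant counterpart of
  `mermin_wagner_staggered_holds`; the half-filled antiferromagnetism targeted by the cell's R2
  rows is therefore a ground-state notion).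

Theorems only: no definition, no named fact, no statement of the tree is changed.
HONEST FRAMING (cell pub-hubbard): ladder R1–R4 with certified numbers; no claim on H/H₀.

## Source

T. Koma, H. Tasaki, *Decay of superconducting and magnetic correlations in one- and
two-dimensional Hubbard models*, PRL **68** (1992) 3248 = arXiv:cond-mat/9709068 (held, read:
p. 3, the remark after the Theorem quoted above; Theorem eqs. (2), (4)); C. N. Yang, PRL **63**
(1989) 2144 (the η-pairs, KT's ref. [6]).
-/

noncomputable section

namespace Literature.MathematicalPhysics.QuantumLattice

open Matrix Filter Literature.Probability.LatticeModels MerminWagner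
open scoped ComplexOrder

/-- No STAGGERED pair long-range order from the Koma–Tasaki pair bound: if the thermal on-site
pair correlation on the tori `(ℤ/Lℤ)²` obeys `|⟨c†_{x↑}c†_{x↓}c_{y↓}c_{y↑}⟩_{β,L}| ≤ C (dist(x,y)+1)^{-f}`,
`f > 0`, uniformly in `L`, then `¬ HasStaggeredEvenTorusLRO (thermalPairCorr β t U μ)` (the
η-pair condensate is excluded like the Cooper-pair one: the decay bound is blind to the sign
`(-1)^{x+y}`). Koma–Tasaki, PRL 68 (1992) 3248, Theorem eq. (2) and the remark after the Theorem
("… such as the Cooper pairs or the η-pairs"). [cite: KomaTasakiPRL1992, Theorem eq. (2) and remark after the Theorem (arXiv p. 3)] -/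
theorem not_hasStaggeredEvenTorusLRO_thermalPairCorr {t U μ β f C : ℝ} (hf : 0 < f)
    (h : ∀ (L : ℕ) [NeZero L] (x y : TorusSite 2 L),
      ‖(hubbardTorusWith 2 L t U μ).thermalCorr β (onSitePair x)ᴴ (onSitePair y)‖ ≤
        C * ((torusDist x y : ℝ) + 1) ^ (-f)) :
    ¬ HasStaggeredEvenTorusLRO (thermalPairCorr (d := 2) β t U μ) := by
  refine not_hasStaggeredEvenTorusLRO_of_abs_le_rpow two_ne_zero (C := C) hf fun L _ x y => ?_
  cases L with
  | zero => exact absurd rfl (NeZero.ne 0)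
  | succ n => exact (Complex.abs_re_le_norm _).trans (h (n + 1) x y)

/-- No STAGGERED (antiferromagnetic) transverse-spin long-range order from the Koma–Tasaki spin
bound: if `|⟨S⁺_x S⁻_y⟩_{β,L}| ≤ C (dist(x,y)+1)^{-f}`, `f > 0`, uniformly in `L` on `(ℤ/Lℤ)²`, then
`¬ HasStaggeredEvenTorusLRO (thermalSpinCorr β t U μ)`. Koma–Tasaki, PRL 68 (1992) 3248, Theorem
eq. (4) and the remark after the Theorem ("… and of the corresponding magnetic ordering").
[cite: KomaTasakiPRL1992, Theorem eq. (4) and remark after the Theorem (arXiv p. 3)] -/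
theorem not_hasStaggeredEvenTorusLRO_thermalSpinCorr {t U μ β f C : ℝ} (hf : 0 < f)
    (h : ∀ (L : ℕ) [NeZero L] (x y : TorusSite 2 L),
      ‖(hubbardTorusWith 2 L t U μ).thermalCorr β (siteSpinPlus x) (siteSpinPlus y)ᴴ‖ ≤
        C * ((torusDist x y : ℝ) + 1) ^ (-f)) :
    ¬ HasStaggeredEvenTorusLRO (thermalSpinCorr (d := 2) β t U μ) := by
  refine not_hasStaggeredEvenTorusLRO_of_abs_le_rpow two_ne_zero (C := C) hf fun L _ x y => ?_
  cases L with
  | zero => exact absurd rfl (NeZero.ne 0)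
  | succ n => exact (Complex.abs_re_le_norm _).trans (h (n + 1) x y)

/-- **No η-pairing (staggered pair) long-range order at `T > 0` in the 2D Hubbard model**
(UNCONDITIONAL): for all `t, U, μ` and every `0 < β`, the thermal on-site pair two-point
function of `hubbardTorusWith 2 L t U μ` has no staggered long-range order along the even tori,
`¬ HasStaggeredEvenTorusLRO (thermalPairCorr β t U μ)`; from `koma_tasaki_2d_holds`. (Yang's
η-paired states `(η†_π)^N|0⟩` are exact EIGENSTATES with off-diagonal long-range order,
`yang_etaPairing_hasODLRO_holds`; the Gibbs state at any positive temperature in `d = 2` has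
none.) Koma–Tasaki, PRL 68 (1992) 3248, Theorem eq. (2) and the remark after it ("inhibits the
condensation of singlet electron pairs such as the Cooper pairs or the η-pairs").
[cite: KomaTasakiPRL1992, Theorem eq. (2) and remark after the Theorem (arXiv p. 3)] -/
theorem hubbard_thermal_not_staggeredPairLRO (t U μ β : ℝ) (hβ : 0 < β) :
    ¬ HasStaggeredEvenTorusLRO (thermalPairCorr (d := 2) β t U μ) := by
  obtain ⟨f, hf, C, hC⟩ := koma_tasaki_2d_holds t U μ β hβ
  exact not_hasStaggeredEvenTorusLRO_thermalPairCorr hf fun L _ x y => hC L x y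

/-- **No antiferromagnetic (staggered transverse-spin) long-range order at `T > 0` in the 2D
Hubbard model** (UNCONDITIONAL): for all `t, U, μ` and every `0 < β`,
`¬ HasStaggeredEvenTorusLRO (thermalSpinCorr β t U μ)` on `(ℤ/Lℤ)²`; from the `d = 2` half of
`koma_tasaki_magnetic_holds`. The itinerant-electron counterpart of Mermin–Wagner's
antiferromagnetic clause (`mermin_wagner_staggered_holds` for the Heisenberg model).
Koma–Tasaki, PRL 68 (1992) 3248, Theorem eq. (4) and the remark after it; D. K. Ghosh, PRL 27
(1971) 1584 (KT ref. [4], the Bogoliubov-inequality form).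
[cite: KomaTasakiPRL1992, Theorem eq. (4) and remark after the Theorem (arXiv p. 3)] -/
theorem hubbard_thermal_not_staggeredSpinLRO (t U μ β : ℝ) (hβ : 0 < β) :
    ¬ HasStaggeredEvenTorusLRO (thermalSpinCorr (d := 2) β t U μ) := by
  obtain ⟨⟨f, hf, C, hC⟩, -⟩ := koma_tasaki_magnetic_holds t U μ β hβ
  exact not_hasStaggeredEvenTorusLRO_thermalSpinCorr hf fun L _ x y => hC L x y

end Literature.MathematicalPhysics.QuantumLattice
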